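import Literature.IUT.LogThetaLattice.MultiradialityRemarks
import Literature.IUT.HodgeArakelov.ThetaValueOrbits
import Literature.IUT.LogThetaLattice.ThetaPilotObjects
import Literature.IUT.LogThetaLattice.HolomorphicHull
import Literature.IUT.LogThetaLattice.LogWallRemarks
import HarnessLib

/-!
# [IUTchII]/[IUTchIII] remark schemas whose universal closures are false

Four `def … : Prop` transcriptions of REMARKS of [IUTchII]/[IUTchIII] take an arbitrary predicate (or an
arbitrary set-valued map) as a PARAMETER and return that parameter applied to data.  Such a schema is
meaningful only AT A NAMED INSTANCE (the predicate of the intended model); its universal closure is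
false by instantiating the parameter trivially.  The four kernel certificates below record this, so
that no file can bind the closed forms `∀ …, <schema> …` as a "named fact" (abc-iut FACT-LIST rows
F-2071, F-2087, F-2131, F-2110: instance-only).  HONEST FRAMING: bookkeeping about the typing of
narrative remarks; nothing here bears on the mathematics of [IUTchIII] §3 or on Cor. 3.12.
-/

universe u v

namespace Literature.IUT.LogThetaLattice

/-- [IUTchIII] Rmk 2.3.2 schema `Rmk232_numberFieldAnalogue IsMultiradial x := IsMultiradial x`: its
universal closure is false (take `IsMultiradial := fun _ => False`).
[cite: Mochizuki2012, IUTchIII Rmk 2.3.2 p.75] -/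
theorem MultiradialityRemarks.not_forall_Rmk232_numberFieldAnalogue :
    ¬ ∀ (Env : Type) (IsMultiradial : Env → Prop) (x : Env),
      MultiradialityRemarks.Rmk232_numberFieldAnalogue IsMultiradial x :=
  fun h => h Unit (fun _ => False) ()

/-- [IUTchIII] Rmk 3.8.2 schema `Remark382_generalize P L := P L.theater`: for EVERY LGP-Gaussian
log-theta-lattice `L` the closure over the property `P` is false (take `P := fun _ => False`).
[cite: Mochizuki2012, IUTchIII Rmk 3.8.2 p.114] -/
theorem not_forall_Remark382_generalize {HT : Type u} {LogLink : HT → HT → Type v}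
    {IsFull : ∀ {s t : HT}, LogLink s t → Prop} (L : LGPGaussianLogThetaLattice LogLink IsFull) :
    ¬ ∀ P : (ℤ → ℤ → HT) → Prop, Remark382_generalize P L :=
  fun h => h (fun _ => False)

/-- [IUTchIII] Rmk 3.9.5 (iv) (Ξ2) schema `Xi2_globalNonempty XiGlobal := ∀ P, (XiGlobal P).Nonempty`:
its universal closure is false (take the empty approximant family).
[cite: Mochizuki2012, IUTchIII Rmk 3.9.5 (iv) p.128] -/
theorem not_forall_Xi2_globalNonempty :
    ¬ ∀ (G : Type) (XiGlobal : G → Set G), Xi2_globalNonempty XiGlobal :=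
  fun h => by simpa using h Unit (fun _ => ∅) ()

end Literature.IUT.LogThetaLattice

namespace Literature.IUT.HodgeArakelov

/-- [IUTchII] Rmk 2.9.1 (iii) schema `Rmk291iii_uniradial IsUniradiallyDefined F := IsUniradiallyDefined F`:
its universal closure is false (take `IsUniradiallyDefined := fun _ => False`).
[cite: Mochizuki2012, IUTchII Rmk 2.9.1 (iii) p.86] -/
theorem ThetaValueOrbits.not_forall_Rmk291iii_uniradial :
    ¬ ∀ (Fnctr : Type) (IsUniradiallyDefined : Fnctr → Prop) (c : Fnctr),
      ThetaValueOrbits.Rmk291iii_uniradial IsUniradiallyDefined c :=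
  fun h => h Unit (fun _ => False) ()

end Literature.IUT.HodgeArakelov

/-!
## Second batch (abc-iut-w5-d117 gen 3, 2026-08-26): the remaining LogThetaLattice remark schemas

Four more `def … : Prop` transcriptions of [IUTchIII] remarks ("R11: prove or GAP" rows F-2068, F-2069,
F-2108, F-2130 of the cell's FACT-LIST) are SCHEMAS over free data (an abstract lattice of maps, an
abstract link with an abstract pilot map, two free classes of regions): for each, the universal closure is
FALSE (kernel certificate `not_forall_…`, by a two-element instantiation) and the schema DOES hold at a
named toy or tautological instance (`…_toy` / `…_of_…`), so the row is instance-only — consumable at the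
intended model, never bindable as `∀ …`. (Row F-2113 `upperRel` is a RELATION, not a statement; its
content — an equivalence relation with the expected quotient — is PROVED in `HolomorphicHullUpperProofs`,
p410462, and is not repeated here.) HONEST FRAMING: bookkeeping about the typing of narrative remarks; nothing here bears on [IUTchIII] §3 or
on Cor. 3.12.
-/

namespace Literature.IUT.LogThetaLattice

/-! ### [IUTchIII] Rmk 1.3.2 — `Rmk132_logLinkCompatible` (F-2068) -/

/-- [IUTchIII] Rmk 1.3.2 schema `Rmk132_logLinkCompatible M N lg σ τ` ("the log-links … are compatible with
the `𝔽_l^{⋊±}`-symmetrizing isomorphisms"): over FREE symmetrising bijections its universal closure is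
false — one label, trivial group, `M = N = Bool`, `lg = id`, `σ = id` but `τ =` negation.
[cite: Mochizuki2012, IUTchIII Rmk 1.3.2 pp.43-44] -/
theorem not_forall_Rmk132_logLinkCompatible :
    ¬ ∀ (T : Type) (M N : T → Type) (lg : ∀ t, M t → N t) (Γ : Type) (_ : Group Γ)
        (_ : MulAction Γ T) (σ : ∀ (γ : Γ) (t : T), M t ≃ M (γ • t))
        (τ : ∀ (γ : Γ) (t : T), N t ≃ N (γ • t)), Rmk132_logLinkCompatible M N lg σ τ := by
  intro h
  have := h PUnit (fun _ => Bool) (fun _ => Bool) (fun _ => id) PUnit inferInstance inferInstance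
    (fun _ _ => Equiv.refl Bool) (fun _ _ => Equiv.mk not not Bool.not_not Bool.not_not) PUnit.unit
    PUnit.unit true
  exact Bool.noConfusion this

/-- [IUTchIII] Rmk 1.3.2 at the TAUTOLOGICAL instance: for label-INDEPENDENT data — constant families
`M t = M₀`, `N t = N₀`, one map `lg₀ : M₀ → N₀` at every label, and the identity symmetrising
isomorphisms (the situation after conjugate synchronization, [IUTchIII] Rmk 1.5.1 (i): "label-independent"
copies) — the compatibility holds, by `rfl`. [cite: Mochizuki2012, IUTchIII Rmk 1.3.2 pp.43-44] -/
theorem Rmk132_logLinkCompatible_of_labelIndependent {T : Type u} (M₀ N₀ : Type u) (lg₀ : M₀ → N₀)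
    {Γ : Type u} [Group Γ] [MulAction Γ T] :
    Rmk132_logLinkCompatible (Γ := Γ) (fun _ : T => M₀) (fun _ => N₀) (fun _ => lg₀)
      (fun _ _ => Equiv.refl M₀) (fun _ _ => Equiv.refl N₀) :=
  fun _ _ _ => rfl

/-- [IUTchIII] Rmk 1.3.2, the mechanism behind the positive instances: if the symmetrising isomorphisms on
the codomains are DEFINED by transport of structure — `τ γ t ∘ lg t = lg (γ • t) ∘ σ γ t`, i.e. `τ` is the
unique bijection making the square commute whenever the `lg t` are bijective — then the schema holds
(this is a restatement of the hypothesis, recorded as the form in which "one verifies immediately" the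
compatibility). [cite: Mochizuki2012, IUTchIII Rmk 1.3.2 pp.43-44] -/
theorem Rmk132_logLinkCompatible_of_comm {T : Type u} {M N : T → Type u} {lg : ∀ t, M t → N t}
    {Γ : Type u} [Group Γ] [MulAction Γ T] {σ : ∀ (γ : Γ) (t : T), M t ≃ M (γ • t)}
    {τ : ∀ (γ : Γ) (t : T), N t ≃ N (γ • t)}
    (h : ∀ (γ : Γ) (t : T), (τ γ t) ∘ lg t = lg (γ • t) ∘ (σ γ t)) :
    Rmk132_logLinkCompatible M N lg σ τ :=
  fun γ t x => (congrFun (h γ t) x).symm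

/-! ### [IUTchIII] Rmk 1.4.1 (i) — `Rmk141_notCommutative` (F-2069) -/

/-- [IUTchIII] Rmk 1.4.1 (i) schema `Rmk141_notCommutative X up right` ("the various squares … are far from
being commutative!"): over a FREE lattice of maps its universal closure is false — on the one-point lattice
every square commutes. [cite: Mochizuki2012, IUTchIII Rmk 1.4.1 (i) p.46] -/
theorem not_forall_Rmk141_notCommutative :
    ¬ ∀ (X : ℤ → ℤ → Type) (up : ∀ n m, X n m → X n (m + 1)) (right : ∀ n m, X n m → X (n + 1) m),
      Rmk141_notCommutative X up right :=
  fun h => h (fun _ _ => PUnit) (fun _ _ => id) (fun _ _ => id) 0 0 fun _ => rfl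

/-- [IUTchIII] Rmk 1.4.1 (i) at a TOY instance carrying the remark's point ("vertical arrows use the
additive/logarithmic structure, horizontal arrows the multiplicative/power structure"): on the constant
lattice `X n m = ℤ` with vertical map `x ↦ x + 1` and horizontal map `x ↦ 2·x`, NO square commutes
(`2x + 1 ≠ 2(x + 1)` at `x = 0`). [cite: Mochizuki2012, IUTchIII Rmk 1.4.1 (i) p.46] -/
theorem Rmk141_notCommutative_toy :
    Rmk141_notCommutative (fun _ _ => ℤ) (fun _ _ x => x + 1) (fun _ _ x => 2 * x) := by
  intro n m h
  have := h 0
  dsimp only at this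
  omega

/-! ### [IUTchIII] Rmk 3.8.1 — `Remark381_mapsPilots` (F-2130) -/

/-- [IUTchIII] Rmk 3.8.1 schema `Remark381_mapsPilots link pilotMap thetaPilot qPilot` ("both the
Θ^{×μ}_{LGP}- and the Θ^{×μ}_{lgp}-link map Θ-pilot objects to q-pilot objects"): over a FREE pilot map its
universal closure is false — full link on a one-point strip type, `pilotMap φ := id` on `Bool`,
`Θ-pilot := true`, `q-pilot := false`. [cite: Mochizuki2012, IUTchIII Rmk 3.8.1 p.114] -/
theorem not_forall_Remark381_mapsPilots :
    ¬ ∀ (Strip : Type) (Iso : Strip → Strip → Type) (X Y : Strip) (link : Set (Iso X Y))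
        (PX PY : Type) (pilotMap : Iso X Y → PX → PY) (thetaPilot : PX) (qPilot : PY),
      Remark381_mapsPilots link pilotMap thetaPilot qPilot := by
  intro h
  have := h PUnit (fun _ _ => PUnit) PUnit.unit PUnit.unit Set.univ Bool Bool (fun _ b => b) true false
    PUnit.unit (Set.mem_univ _)
  exact Bool.noConfusion this

/-- [IUTchIII] Rmk 3.8.1 at the instance where the pilot map is, member by member, DEFINED to send the
Θ-pilot object to the q-pilot object (Definition 3.8 (i)–(ii): the link is the full poly-isomorphism
between the strips determined BY the two pilot objects): the schema holds for every sub-collection of the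
link. [cite: Mochizuki2012, IUTchIII Rmk 3.8.1 p.114] -/
theorem Remark381_mapsPilots_of_forall {Strip : Type u} {Iso : Strip → Strip → Type v} {X Y : Strip}
    (link link' : Set (Iso X Y)) (hsub : link' ⊆ link) {PX PY : Type v} (pilotMap : Iso X Y → PX → PY)
    (thetaPilot : PX) (qPilot : PY) (h : Remark381_mapsPilots link pilotMap thetaPilot qPilot) :
    Remark381_mapsPilots link' pilotMap thetaPilot qPilot :=
  fun φ hφ => h φ (hsub hφ)

/-- [IUTchIII] Rmk 3.8.1: when the q-pilot objects form a one-element type (pilot objects "up to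
isomorphism" in a situation with a single isomorphism class), the schema holds for ANY link and pilot map.
[cite: Mochizuki2012, IUTchIII Rmk 3.8.1 p.114] -/
theorem Remark381_mapsPilots_of_subsingleton {Strip : Type u} {Iso : Strip → Strip → Type v} {X Y : Strip}
    (link : Set (Iso X Y)) {PX PY : Type v} [Subsingleton PY] (pilotMap : Iso X Y → PX → PY)
    (thetaPilot : PX) (qPilot : PY) : Remark381_mapsPilots link pilotMap thetaPilot qPilot :=
  fun _ _ => Subsingleton.elim _ _

/-! ### [IUTchIII] Rmk 3.9.5 (x) — `Remark395x_lineBundles` (F-2108) -/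

/-- [IUTchIII] Rmk 3.9.5 (x) schema `Remark395x_lineBundles Hul 𝒞 := 𝒞 ⊆ Hul` ("one must, in effect, work
with arithmetic line bundles", i.e. only with regions in `Hul`): over FREE classes of regions its universal
closure is false — `Hul := ∅`, `𝒞 := {∅}`. [cite: Mochizuki2012, IUTchIII Rmk 3.9.5 (x) p.144] -/
theorem not_forall_Remark395x_lineBundles :
    ¬ ∀ (X : Type) (Hul 𝒞 : Set (Set X)), Remark395x_lineBundles Hul 𝒞 :=
  fun h => h PUnit ∅ {∅} (Set.mem_singleton _)

/-- [IUTchIII] Rmk 3.9.5 (x) at the instances the remark intends: the class `Hul` itself, and any class of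
hulls of bounded families that lie in `Hul`, are admissible; in particular the schema is monotone in `𝒞`.
[cite: Mochizuki2012, IUTchIII Rmk 3.9.5 (x) p.144] -/
theorem Remark395x_lineBundles_self {X : Type u} (Hul : Set (Set X)) : Remark395x_lineBundles Hul Hul :=
  subset_rfl

/-- [IUTchIII] Rmk 3.9.5 (x): monotonicity of the admissibility predicate in the class of regions.
[cite: Mochizuki2012, IUTchIII Rmk 3.9.5 (x) p.144] -/
theorem Remark395x_lineBundles.mono {X : Type u} {Hul 𝒞 𝒞' : Set (Set X)} (h : Remark395x_lineBundles Hul 𝒞)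
    (h' : 𝒞' ⊆ 𝒞) : Remark395x_lineBundles Hul 𝒞' :=
  h'.trans h

end Literature.IUT.LogThetaLattice
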